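import Summits.BirchSwinnertonDyer.Rank1Residual.X12.O11.RouteUBiprimeMember
import Summits.BirchSwinnertonDyer.Rank1Residual.X12.O11.RouteUBiprimeFullBSD
import Summits.BirchSwinnertonDyer.Rank1Residual.X12.O11.RouteUEulerCriterionNat
import Summits.BirchSwinnertonDyer.Rank1Residual.X12.O11.RouteUMemberD667BlocksA
import Summits.BirchSwinnertonDyer.Rank1Residual.X12.O11.RouteUMemberD667BlocksB
import HarnessLib

/-!
# ROUTE U, composite member `D = −667 = −23·29` (curve `49a1^{(−667)}`, `N = 49·667²`), Heegner field
# `K'' = ℚ(√−83)`: the two Bernoulli-unit certificates and BSD₇ by the bi-prime-member class theorem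

bsd-cm cell (run/shared/lean/pub/bsd-cm/), ROUTE U, seat `bsd-cm-ram` (g6). Instance of
`RouteU.bsdp_seven_of_twist_cm7_biprime` at `(q₁, q₂, r) = (23, 29, 83)`: `667 ≡ 83 ≡ 3 (mod 4)`,
`(−83/7) = (−83/23) = (−83/29) = 1`. The member `49a1^{(−667)}` is an O11 pair at `7` (CM by `ℚ(√−7)`,
`7` ramified) and a member of `𝒞₇` (23, 29 split in `ℚ(√−7)`; conductor beyond the N < 5·10⁵ census window), so BSD₇ AND the FULL-BSD corollary `forall_bsdp_of_twist_cm7_D667` are drawn.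
The per-member inputs are the two kernel certificates (`decide +kernel`, mod-`49` sums of lengths `4669`
and `387527`, the second in 20 blocks of ≤ 20000 terms; the Jacobi symbol `J(j|667)` is
rewritten as `J(j|23)J(j|29)` and each prime Jacobi symbol as a `Fact`-free Euler-criterion `if` in `ℕ`-arithmetic
(`RouteUEulerCriterionNat.jacobiSym_prime_eq_ite_nat`), so no `Fact (Nat.Prime _)` instance is declared here; the blocks live in `RouteUMemberD667BlocksA`, `RouteUMemberD667BlocksB`):
* `norm_generalizedBernoulli_theta1_D667` — `‖B_{1,ω⁴χ_{−667}}‖₇ = 1`;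
* `norm_generalizedBernoulli_theta2_D667` — `‖B_{1,ωχ_{−667}χ_{−83}}‖₇ = 1`;
* **`bsdp_seven_of_twist_cm7_D667`** — BSD₇ for every globally minimal model of `49a1^{(−667)}` with
  `r_an = 1`, from the class theorem (named facts: Kriz–Li Thm 1.20 / Rem 3.10, Gross–Zagier, Kolyvagin,
  GZK, modularity, Rubin 1983 Thm C, Burungale–Flach 2024, Buhler–Gross 1985 Ch. II; displayed data:
  Heegner datum over `ℚ(√−83)`, a Mordell–Weil coordinate over `K`, `L(W^{(−83)},1) ≠ 0`, the twin's
  minimal model, `7 ∤ c` (Manin constant)).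
THEOREMS ONLY; nothing booked. References: [KrizLi2019] Thm. 1.20; [Washington1997] §5.1, Thm 4.2;
[Rubin1983] Thm C; [BuhlerGross1985] Ch. II; [BurungaleFlach2024] Thm 1.1; [Miller2011LMS] Def. 1.1.
-/

noncomputable section

open scoped Classical
open NumberField WeierstrassCurve DirichletCharacter
open Literature.NumberTheory.EllipticCurves Literature.NumberTheory.EllipticCurves.Rank1Residual
open Literature.NumberTheory.EllipticCurves.KrizLi2019 Literature.NumberTheory.LFunctions
open Literature.NumberTheory.EllipticCurves.ModularForms

namespace Summit.BirchSwinnertonDyer.Rank1Residual.X12.O11.RouteU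

/-- `ord₇ (7·667) = 1`. [folklore] -/
theorem padicValNat_seven_level1_D667 : padicValNat 7 (7 * (23 * 29)) = 1 := by
  rw [padicValNat.mul (by norm_num) (by norm_num), padicValNat_self, padicValNat.eq_zero_of_not_dvd (by norm_num)]

/-- `ord₇ (7·667·83) = 1`. [folklore] -/
theorem padicValNat_seven_level2_D667 : padicValNat 7 (7 * (23 * 29) * 83) = 1 := by
  rw [show (7 * (23 * 29) * 83 : ℕ) = 7 * (667 * 83) by norm_num, padicValNat.mul (by norm_num) (by norm_num),
    padicValNat_self, padicValNat.eq_zero_of_not_dvd (by norm_num)]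

/-- `J(a | 23·29) = J(a | 23)·J(a | 29)`. [cite: Cox2013, §1.C Lemma 1.14] -/
theorem jacobiSym_D667_eq (x : ℤ) : jacobiSym x (23 * 29) = jacobiSym x 23 * jacobiSym x 29 :=
  jacobiSym_mul_right' x (by norm_num) (by norm_num)

set_option maxRecDepth 400000 in
/-- **`‖B_{1,θ₁}‖₇ = 1`** for every character `θ₁` mod `7·667` with values `J(j|667)·ω(j)⁴`, `ω`
Teichmüller (certificate `7 ∥ Σ_{j<4669} (j/23)(j/29) j²⁹`, `decide +kernel`).
[cite: KrizLi2019, Thm. 1.20 (p. 8) and §1.5 (1)] [cite: Washington1997, §5.1 and Thm. 4.2] -/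
theorem norm_generalizedBernoulli_theta1_D667 (ω : DirichletCharacter ℚ_[7] 7)
    (hω : IsTeichmullerCharacter ω) (θ : DirichletCharacter ℚ_[7] (7 * (23 * 29)))
    (hθ : ∀ j : ZMod (7 * (23 * 29)), θ j =
      (jacobiSym (j.val : ℤ) (23 * 29) : ℚ_[7]) * ω (j.val : ZMod 7) ^ 4) :
    ‖generalizedBernoulli 1 θ‖ = 1 := by
  have hθ' : ∀ j : ZMod (7 * (23 * 29)), θ j =
      ((jacobiSym (j.val : ℤ) 23 * jacobiSym (j.val : ℤ) 29 : ℤ) : ℚ_[7]) * ω (j.val : ZMod 7) ^ 4 :=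
    fun j => by rw [hθ j, jacobiSym_D667_eq]
  have hθ1 : θ ≠ 1 := by
    intro h1
    have hv := hθ' (((4668 : ℕ)) : ZMod (7 * (23 * 29)))
    have hval : (((4668 : ℕ) : ZMod (7 * (23 * 29)))).val = 4668 := by
      rw [ZMod.val_natCast]
    have h6 : (((4668 : ℕ)) : ZMod 7) = ((6 : ℕ) : ZMod 7) := by decide
    have hu : IsUnit (((4668 : ℕ)) : ZMod (7 * (23 * 29))) := by
      rw [ZMod.isUnit_iff_coprime]; norm_num
    rw [h1, hval, MulChar.one_apply hu, h6, apply_neg_one_pow_four, mul_one] at hv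
    have hL : jacobiSym ((4668 : ℕ) : ℤ) 23 * jacobiSym ((4668 : ℕ) : ℤ) 29 = -1 := by
      rw [jacobiSym_prime_eq_ite_nat 23 (by norm_num) (by norm_num),
        jacobiSym_prime_eq_ite_nat 29 (by norm_num) (by norm_num)]; decide
    rw [hL] at hv
    norm_num at hv
  refine norm_generalizedBernoulli_one_eq_one_of_cert θ hθ1 padicValNat_seven_level1_D667
    (fun j => jacobiSym (j.val : ℤ) 23 * jacobiSym (j.val : ℤ) 29) 28 (fun j => ?_) ?_ ?_
  · have := norm_sub_le_of_values ω hω θ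
      (fun n => jacobiSym (n : ℤ) 23 * jacobiSym (n : ℤ) 29) 4 (by norm_num) hθ' j
    simpa using this
  · simp_rw [jacobiSym_prime_eq_ite_nat 23 (by norm_num) (by norm_num),
      jacobiSym_prime_eq_ite_nat 29 (by norm_num) (by norm_num)]
    decide +kernel
  · simp_rw [jacobiSym_prime_eq_ite_nat 23 (by norm_num) (by norm_num),
      jacobiSym_prime_eq_ite_nat 29 (by norm_num) (by norm_num)]
    decide +kernel

/-- The `θ₂` certificate sum for `D = −667` assembled from its blocks, `7 ∥ S₂`. [folklore] -/
theorem theta2_D667_sum :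
    ∑ j ∈ Finset.range (7 * (23 * 29) * 83),
      (jacobiSym (j : ℤ) 23 * jacobiSym (j : ℤ) 29 * jacobiSym (j : ℤ) 83) * (j : ℤ) ^ (7 + 1) = 8356714655583000066703375403189760630947478528 := by
  rw [Finset.range_eq_Ico, ← Finset.sum_Ico_consecutive _ (show 0 ≤ 20000 by norm_num) (show 20000 ≤ 7 * (23 * 29) * 83 by norm_num), ← Finset.sum_Ico_consecutive _ (show 20000 ≤ 40000 by norm_num) (show 40000 ≤ 7 * (23 * 29) * 83 by norm_num), ← Finset.sum_Ico_consecutive _ (show 40000 ≤ 60000 by norm_num) (show 60000 ≤ 7 * (23 * 29) * 83 by norm_num), ← Finset.sum_Ico_consecutive _ (show 60000 ≤ 80000 by norm_num) (show 80000 ≤ 7 * (23 * 29) * 83 by norm_num), ← Finset.sum_Ico_consecutive _ (show 80000 ≤ 100000 by norm_num) (show 100000 ≤ 7 * (23 * 29) * 83 by norm_num), ← Finset.sum_Ico_consecutive _ (show 100000 ≤ 120000 by norm_num) (show 120000 ≤ 7 * (23 * 29) * 83 by norm_num), ← Finset.sum_Ico_consecutive _ (show 120000 ≤ 140000 by norm_num)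 (show 140000 ≤ 7 * (23 * 29) * 83 by norm_num), ← Finset.sum_Ico_consecutive _ (show 140000 ≤ 160000 by norm_num) (show 160000 ≤ 7 * (23 * 29) * 83 by norm_num), ← Finset.sum_Ico_consecutive _ (show 160000 ≤ 180000 by norm_num) (show 180000 ≤ 7 * (23 * 29) * 83 by norm_num), ← Finset.sum_Ico_consecutive _ (show 180000 ≤ 200000 by norm_num) (show 200000 ≤ 7 * (23 * 29) * 83 by norm_num), ← Finset.sum_Ico_consecutive _ (show 200000 ≤ 220000 by norm_num) (show 220000 ≤ 7 * (23 * 29) * 83 by norm_num), ← Finset.sum_Ico_consecutive _ (show 220000 ≤ 240000 by norm_num) (show 240000 ≤ 7 * (23 * 29) * 83 by norm_num), ← Finset.sum_Ico_consecutive _ (show 240000 ≤ 260000 by norm_num) (show 260000 ≤ 7 * (23 * 29) * 83 by norm_num), ← Finset.sum_Ico_consecutive _ (show 260000 ≤ 280000 by norm_num) (show 280000 ≤ 7 * (23 * 29) * 83 by norm_num), ← Finset.sum_Ico_consecutive _ (show 280000 ≤ 300000 by norm_num) (show 300000 ≤ 7 * (23 * 29) * 83 by norm_num), ← Finset.sum_Ico_consecutive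 _ (show 300000 ≤ 320000 by norm_num) (show 320000 ≤ 7 * (23 * 29) * 83 by norm_num), ← Finset.sum_Ico_consecutive _ (show 320000 ≤ 340000 by norm_num) (show 340000 ≤ 7 * (23 * 29) * 83 by norm_num), ← Finset.sum_Ico_consecutive _ (show 340000 ≤ 360000 by norm_num) (show 360000 ≤ 7 * (23 * 29) * 83 by norm_num), ← Finset.sum_Ico_consecutive _ (show 360000 ≤ 380000 by norm_num) (show 380000 ≤ 7 * (23 * 29) * 83 by norm_num), theta2_D667_block0, theta2_D667_block1, theta2_D667_block2, theta2_D667_block3, theta2_D667_block4, theta2_D667_block5, theta2_D667_block6, theta2_D667_block7, theta2_D667_block8, theta2_D667_block9, theta2_D667_block10, theta2_D667_block11, theta2_D667_block12, theta2_D667_block13, theta2_D667_block14, theta2_D667_block15, theta2_D667_block16, theta2_D667_block17, theta2_D667_block18, theta2_D667_block19]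
  norm_num

set_option maxRecDepth 400000 in
/-- **`‖B_{1,θ₂}‖₇ = 1`** for every character `θ₂` mod `7·667·83` with values `J(j|667)·J(j|83)·ω(j)`
(certificate `7 ∥ Σ_{j<387527} (j/23)(j/29)(j/83) j⁸`, `decide +kernel`).
[cite: KrizLi2019, Thm. 1.20 (p. 8) and §1.5 (1)] [cite: Washington1997, §5.1 and Thm. 4.2] -/
theorem norm_generalizedBernoulli_theta2_D667 (ω : DirichletCharacter ℚ_[7] 7)
    (hω : IsTeichmullerCharacter ω) (θ : DirichletCharacter ℚ_[7] (7 * (23 * 29) * 83))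
    (hθ : ∀ j : ZMod (7 * (23 * 29) * 83), θ j =
      ((jacobiSym (j.val : ℤ) (23 * 29) * jacobiSym (j.val : ℤ) 83 : ℤ) : ℚ_[7]) * ω (j.val : ZMod 7) ^ 1) :
    ‖generalizedBernoulli 1 θ‖ = 1 := by
  have hθ' : ∀ j : ZMod (7 * (23 * 29) * 83), θ j =
      ((jacobiSym (j.val : ℤ) 23 * jacobiSym (j.val : ℤ) 29 * jacobiSym (j.val : ℤ) 83 : ℤ) : ℚ_[7]) *
        ω (j.val : ZMod 7) ^ 1 :=
    fun j => by rw [hθ j, jacobiSym_D667_eq]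
  have hθ1 : θ ≠ 1 := by
    intro h1
    have hv := hθ' (((387526 : ℕ)) : ZMod (7 * (23 * 29) * 83))
    have hval : (((387526 : ℕ) : ZMod (7 * (23 * 29) * 83))).val = 387526 := by
      rw [ZMod.val_natCast]
    have hu : IsUnit (((387526 : ℕ)) : ZMod (7 * (23 * 29) * 83)) := by
      rw [ZMod.isUnit_iff_coprime]; norm_num
    rw [h1, hval, MulChar.one_apply hu, pow_one] at hv
    have hL : jacobiSym ((387526 : ℕ) : ℤ) 23 * jacobiSym ((387526 : ℕ) : ℤ) 29 *
        jacobiSym ((387526 : ℕ) : ℤ) 83 = 1 := by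
      rw [jacobiSym_prime_eq_ite_nat 23 (by norm_num) (by norm_num),
        jacobiSym_prime_eq_ite_nat 29 (by norm_num) (by norm_num),
        jacobiSym_prime_eq_ite_nat 83 (by norm_num) (by norm_num)]; decide
    rw [hL, Int.cast_one, one_mul] at hv
    -- `ω(−1) = 1` contradicts `‖ω(6) − 6‖ < 1`
    have h6 : (((387526 : ℕ)) : ZMod 7) = ((6 : ℤ) : ZMod 7) := by decide
    rw [h6] at hv
    have hT := hω 6 (by decide)
    rw [← hv] at hT
    have : ‖(1 : ℚ_[7]) - ((6 : ℤ) : ℚ_[7])‖ = 1 := by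
      rw [show (1 : ℚ_[7]) - ((6 : ℤ) : ℚ_[7]) = -((5 : ℕ) : ℚ_[7]) by norm_num, norm_neg]
      exact Padic.norm_natCast_eq_one_iff.mpr (by decide)
    rw [this] at hT
    exact lt_irrefl _ hT
  refine norm_generalizedBernoulli_one_eq_one_of_cert_range θ hθ1 padicValNat_seven_level2_D667
    (fun j => jacobiSym (j : ℤ) 23 * jacobiSym (j : ℤ) 29 * jacobiSym (j : ℤ) 83) 7 (fun j => ?_) 8356714655583000066703375403189760630947478528
    theta2_D667_sum (by norm_num) (by norm_num)
  have := norm_sub_le_of_values ω hω θ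
    (fun n => jacobiSym (n : ℤ) 23 * jacobiSym (n : ℤ) 29 * jacobiSym (n : ℤ) 83) 1 le_rfl hθ' j
  simpa using this

/-- **ROUTE U, member `D = −667` (`49a1^{(−667)}`, `N = 49·667²`): BSD₇ for every globally minimal model of
`49a1^{(−667)}` with `r_an = 1`**, by the bi-prime-member class theorem at `(q₁, q₂, r) = (23, 29, 83)`
with the two certificates above; the descent inputs (no `7`-torsion over `K`, `7 ∤ #Ш(W)`) are discharged
inside the class theorem (Mazur's local step; Buhler–Gross 1985 Ch. II BY NAME, binder `hBG`).
[cite: KrizLi2019, Thm. 1.20 and Rem. 3.10] [cite: Rubin1983, §0 Thm. C (p. 341)]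
[cite: BurungaleFlach2024, Thm 1.1 and Cor. 2] [cite: GrossZagier1986, I.(6.5) and V.(2.1)]
[cite: Miller2011LMS, Thm. 2.5 and (5.1)] [cite: BuhlerGross1985, Ch. II (7.2)(2), (8.3)(1), (9.1) (pp. 16–18)] -/
theorem bsdp_seven_of_twist_cm7_D667
    (hKL : KrizLi2019.thm120_padicLogHeegner_unit_of_bernoulli)
    (hRem : KrizLi2019.rem310_padicLogHeegner_integral)
    (W : WeierstrassCurve ℚ) [W.IsElliptic] [W.IsGloballyMinimal] [NeZero (W.conductorNorm ℤ)]
    (hW : ∃ C : VariableChange ℚ, C • W = cm7.quadraticTwist ((-((23 * 29 : ℕ)) : ℤ) : ℚ))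
    (K : Type) [Field K] [NumberField K] [NeZero (NumberField.discr K).natAbs]
    (hK : IsImaginaryQuadratic K) (hdK : NumberField.discr K = -(83 : ℕ))
    (D : ModularParametrizationData W (W.conductorNorm ℤ))
    (H : HeegnerDatum (W.conductorNorm ℤ) (NumberField.discr K)) (ι : K →+* ℂ) (ιp : K →+* ℚ_[7])
    (P : (W.baseChange K).toAffine.Point)
    (hGZ : gross_zagier (W.conductorNorm ℤ) W K) (hKo : kolyvagin (W.conductorNorm ℤ) W K)
    (hGZK : rank_eq_analyticRank_of_analyticRank_le_one) (hmod : hasEntireLFunction_rat)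
    (hP : WeierstrassCurve.Affine.Point.map ι.toRatAlgHom P = heegnerPointComplex D H)
    (hr1 : W.analyticRank = 1)
    (hLt : (W.quadraticTwist (NumberField.discr K : ℚ)).entireLFunction 1 ≠ 0)
    (Wd : WeierstrassCurve ℚ) [Wd.IsElliptic] [Wd.IsGloballyMinimal] (Cd : VariableChange ℚ)
    (hWd : Cd • W.quadraticTwist (NumberField.discr K : ℚ) = Wd)
    (hBF : bsdTriple_of_hasCM_of_L_one_ne_zero)
    (hu : padicValRat 7 (Cd.u : ℚ) = 0)
    (hC : Rubin1983.thmC_seven_quadraticField)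
    (hBG : BuhlerGross1985.firstDescent_seven_oddTwist_of_bernoulli)
    [Finite (AddCommGroup.torsion (W.baseChange K).toAffine.Point)]
    (crd : (W.baseChange K).toAffine.Point →+ ℤ) (g : (W.baseChange K).toAffine.Point)
    (hg : crd g = 1) (hker : ∀ x, crd x = 0 → IsOfFinAddOrder x)
    (hc7 : ¬ ((7 : ℤ) ∣ D.c)) :
    BSDp W 7 :=
  bsdp_seven_of_twist_cm7_biprime (q₁ := 23) (q₂ := 29) (r := 83) (hq₁ := ⟨by norm_num⟩) (hq₂ := ⟨by norm_num⟩)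
    (hr := ⟨by norm_num⟩) (by norm_num) (by norm_num) (by norm_num)
    (by norm_num) (by norm_num) (by norm_num) (by norm_num) (by norm_num) (by norm_num)
    (by rw [legendreSym_eq_ite 7 (by norm_num)]; decide)
    (by rw [jacobiSym.legendreSym.to_jacobiSym, jacobiSym_prime_eq_ite 23 (by norm_num) (by norm_num)]; decide)
    (by rw [jacobiSym.legendreSym.to_jacobiSym, jacobiSym_prime_eq_ite 29 (by norm_num) (by norm_num)]; decide)
    (norm_generalizedBernoulli_theta1_D667) (norm_generalizedBernoulli_theta2_D667)
    hKL hRem W hW K hK hdK D H ι ιp P hGZ hKo hGZK hmod hP hr1 hLt Wd Cd hWd hBF hu hC hBG crd g hg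
    hker hc7

/-- **ROUTE U, member `D = −667`: FULL BSD** (Miller's `BSD(E,p)` at EVERY prime `p`) for every globally minimal model of
`49a1^{(−667)}` with `r_an = 1` — `W ∈ 𝒞₇` since `(−7/23) = (−7/29) = 1` (both primes split in `ℚ(√−7)`,
`classCSeven_of_twist_cm7_biprime`) — by `forall_bsdp_of_twist_cm7_biprime` at `(q₁, q₂, r) = (23, 29, 83)`: BSD₇ from
the two certificates above, BSD_p for `p ≠ 7` from the 𝒞₇ assembly `ClassCSeven.forall_bsdp_iff_bsdp_seven` (named facts
Li–Liu–Tian 2024, Kobayashi 2013, Li–Tian–Yan–Zhu 2025, Burungale–Flach 2024, modularity).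
[cite: Miller2011LMS, §1 and Def. 1.1 (arXiv:1010.2431 p. 3)] [cite: KrizLi2019, Thm. 1.20 and Rem. 3.10] -/
theorem forall_bsdp_of_twist_cm7_D667
    (hKL : KrizLi2019.thm120_padicLogHeegner_unit_of_bernoulli)
    (hRem : KrizLi2019.rem310_padicLogHeegner_integral)
    (W : WeierstrassCurve ℚ) [W.IsElliptic] [W.IsGloballyMinimal] [NeZero (W.conductorNorm ℤ)]
    (hW : ∃ C : VariableChange ℚ, C • W = cm7.quadraticTwist ((-((23 * 29 : ℕ)) : ℤ) : ℚ))
    (K : Type) [Field K] [NumberField K] [NeZero (NumberField.discr K).natAbs]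
    (hK : IsImaginaryQuadratic K) (hdK : NumberField.discr K = -(83 : ℕ))
    (D : ModularParametrizationData W (W.conductorNorm ℤ))
    (H : HeegnerDatum (W.conductorNorm ℤ) (NumberField.discr K)) (ι : K →+* ℂ) (ιp : K →+* ℚ_[7])
    (P : (W.baseChange K).toAffine.Point)
    (hGZ : gross_zagier (W.conductorNorm ℤ) W K) (hKo : kolyvagin (W.conductorNorm ℤ) W K)
    (hGZK : rank_eq_analyticRank_of_analyticRank_le_one) (hmod : hasEntireLFunction_rat)
    (hP : WeierstrassCurve.Affine.Point.map ι.toRatAlgHom P = heegnerPointComplex D H)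
    (hr1 : W.analyticRank = 1)
    (hLt : (W.quadraticTwist (NumberField.discr K : ℚ)).entireLFunction 1 ≠ 0)
    (Wd : WeierstrassCurve ℚ) [Wd.IsElliptic] [Wd.IsGloballyMinimal] (Cd : VariableChange ℚ)
    (hWd : Cd • W.quadraticTwist (NumberField.discr K : ℚ) = Wd)
    (hBF : bsdTriple_of_hasCM_of_L_one_ne_zero)
    (hu : padicValRat 7 (Cd.u : ℚ) = 0)
    (hC : Rubin1983.thmC_seven_quadraticField)
    (hBG : BuhlerGross1985.firstDescent_seven_oddTwist_of_bernoulli)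
    [Finite (AddCommGroup.torsion (W.baseChange K).toAffine.Point)]
    (crd : (W.baseChange K).toAffine.Point →+ ℤ) (g : (W.baseChange K).toAffine.Point)
    (hg : crd g = 1) (hker : ∀ x, crd x = 0 → IsOfFinAddOrder x)
    (hc7 : ¬ ((7 : ℤ) ∣ D.c)) (hLLT : LiLiuTian2024.thm11_bsdp_of_cm_rank_one)
    (hKob : Kobayashi2013.cor14_bsdp_of_cm_rank_one) (hLTYZ : LiTianYanZhu2025.thm11_bsdp_of_cm_rank_one) :
    ∀ p : ℕ, p.Prime → BSDp W p :=
  forall_bsdp_of_twist_cm7_biprime (q₁ := 23) (q₂ := 29) (r := 83) (hq₁ := ⟨by norm_num⟩) (hq₂ := ⟨by norm_num⟩)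
    (hr := ⟨by norm_num⟩) (by norm_num) (by norm_num) (by norm_num)
    (by norm_num) (by norm_num) (by norm_num) (by norm_num) (by norm_num) (by norm_num)
    (by rw [legendreSym_eq_ite 7 (by norm_num)]; decide)
    (by rw [jacobiSym.legendreSym.to_jacobiSym, jacobiSym_prime_eq_ite 23 (by norm_num) (by norm_num)]; decide)
    (by rw [jacobiSym.legendreSym.to_jacobiSym, jacobiSym_prime_eq_ite 29 (by norm_num) (by norm_num)]; decide)
    (by rw [jacobiSym.legendreSym.to_jacobiSym, jacobiSym_prime_eq_ite 23 (by norm_num) (by norm_num)]; decide)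
    (by rw [jacobiSym.legendreSym.to_jacobiSym, jacobiSym_prime_eq_ite 29 (by norm_num) (by norm_num)]; decide)
    (norm_generalizedBernoulli_theta1_D667) (norm_generalizedBernoulli_theta2_D667)
    hKL hRem W hW K hK hdK D H ι ιp P hGZ hKo hGZK hmod hP hr1 hLt Wd Cd hWd hBF hu hC hBG crd g hg
    hker hc7 hLLT hKob hLTYZ

end Summit.BirchSwinnertonDyer.Rank1Residual.X12.O11.RouteU

end
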